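import Summits.Ventures.PercRepro.C026PFunTree

/-!
# Trees over good pendant skeletons (p6, gen 16)

The glue step of the tree invariant uses of the pendant skeleton only `(P_{F₁})_u ≥ 0` (and the
general bounds on its sums), so the leaves of the recursion may be ANY pendant skeletons on which `(P)`
is known to be nonnegative: `IsTreeOver G Good c F` builds `F` at the root `c` by gluing pendant parts
that are themselves such trees or satisfy `Good`; if `Good u F₁` implies `(P_{F₁})_u ≥ 0` at every
band state, then `(P_F) ≥ 0` (`IsTreeOver.pFun_nonneg`).  With `Good` = «a cycle through `u` whose
closing edge satisfies EM(corner)» this is mine-3's cactus-type reduction for cycles hanging at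
tree vertices.
-/

namespace PercRepro

namespace MultiGraph

open Finset

variable {V E : Type*} [Fintype V] [DecidableEq V] [Fintype E] [DecidableEq E] {G : MultiGraph V E}

/-- The glue step of the invariant needs only `(P_{F₁})_u ≥ 0` of the pendant skeleton. -/
theorem treeInv_glue_of_nonneg {F₀ F₁ : Finset E} {e : E} {c u : V} (hg : IsGlue G F₀ e F₁ c u)
    {x K : V → ℝ} (hx : ∀ v, 0 ≤ x v ∧ x v ≤ 1) (hK : ∀ v, kMin (x v) ≤ K v)
    (h₀ : G.TreeInv c x K F₀) (hP₁ : 0 ≤ G.pFun u x K F₁) :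
    G.TreeInv c x K (F₀ ∪ insert e F₁) := by
  obtain ⟨n, d, hd, hm, hz, hc, hdd⟩ := h₀
  have hK0 : ∀ v, 0 ≤ K v := fun v => (kMin_nonneg _).trans (hK v)
  refine ⟨n + 1, Fin.cons (G.mSum x u F₁, G.zSum x u F₁, G.pFun u x K F₁) d, ?_, ?_, ?_, ?_, ?_⟩
  · intro i
    refine Fin.cases ?_ (fun j => ?_) i
    · rw [Fin.cons_zero]
      exact ⟨one_le_mSum hx u F₁, (zSum_le_mSum hx u F₁).1, (zSum_le_mSum hx u F₁).2, hP₁,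
        mSum_sub_two_zSum_le_pFun hx hK0 u F₁⟩
    · rw [Fin.cons_succ]
      exact hd j
  · rw [pow_succ, mul_assoc, hg.mSum_glue x hx, nSum_eq x u, Fin.prod_univ_succ, Fin.cons_zero]
    simp only [Fin.cons_succ]
    linear_combination (3 * G.mSum x u F₁ - G.zSum x u F₁) * hm
  · rw [pow_succ, mul_assoc, hg.zSum_glue x hx, nSum_eq x u, Fin.prod_univ_succ, Fin.cons_zero]
    simp only [Fin.cons_succ]
    linear_combination (2 * G.mSum x u F₁) * hz
  · rw [pow_succ, mul_assoc, hg.sC_glue x K hx, cSum_eq, Fin.prod_univ_succ, Fin.cons_zero]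
    simp only [Fin.cons_succ]
    linear_combination (G.pFun u x K F₁ + 2 * G.zSum x u F₁) * hc
  · rw [pow_succ, mul_assoc, hg.sD_glue x K hx, cSum_eq, Fin.prod_univ_succ, Fin.cons_zero]
    simp only [Fin.cons_succ]
    linear_combination (G.pFun u x K F₁ - G.mSum x u F₁ + 3 * G.zSum x u F₁) * hdd

/-- `IsTreeOver G Good c F`: a tree at the root `c` whose pendant parts are such trees or `Good`
skeletons. -/
inductive IsTreeOver (G : MultiGraph V E) (Good : V → Finset E → Prop) : V → Finset E → Prop
  | nil (c : V) : IsTreeOver G Good c ∅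
  | glue {c u : V} {e : E} {F₀ F₁ : Finset E} (hg : IsGlue G F₀ e F₁ c u)
      (h₀ : IsTreeOver G Good c F₀) (h₁ : IsTreeOver G Good u F₁) :
      IsTreeOver G Good c (F₀ ∪ insert e F₁)
  | glueGood {c u : V} {e : E} {F₀ F₁ : Finset E} (hg : IsGlue G F₀ e F₁ c u)
      (h₀ : IsTreeOver G Good c F₀) (h₁ : Good u F₁) :
      IsTreeOver G Good c (F₀ ∪ insert e F₁)

/-- **(P) ≥ 0 on trees over good pendant skeletons**: if every `Good` skeleton has `(P) ≥ 0` at every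
band state, so has every `IsTreeOver` skeleton. -/
theorem IsTreeOver.pFun_nonneg {Good : V → Finset E → Prop}
    (hGood : ∀ u F, Good u F → ∀ x K : V → ℝ, (∀ v, 0 ≤ x v ∧ x v ≤ 1) →
      (∀ v, kMin (x v) ≤ K v) → 0 ≤ G.pFun u x K F)
    {c : V} {F : Finset E} (h : IsTreeOver G Good c F) {x K : V → ℝ}
    (hx : ∀ v, 0 ≤ x v ∧ x v ≤ 1) (hK : ∀ v, kMin (x v) ≤ K v) : 0 ≤ G.pFun c x K F := by
  suffices hinv : G.TreeInv c x K F from pFun_nonneg_of_treeInv hx hK hinv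
  induction h with
  | nil c => exact treeInv_empty c x K
  | glue hg _ _ ih₀ ih₁ =>
    exact treeInv_glue_of_nonneg hg hx hK ih₀ (pFun_nonneg_of_treeInv hx hK ih₁)
  | @glueGood c u e F₀ F₁ hg _ h₁ ih₀ =>
    exact treeInv_glue_of_nonneg hg hx hK ih₀ (hGood u F₁ h₁ x K hx hK)

end MultiGraph

end PercRepro
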